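import Summits.SmoothPoincare4.SmoothPoincare4.Theorems.SymplecticOrigamiGromovRecognitionRelEndHelperSphereSectionOfIndexZero
import Literature.Topology.PlaneTopology.WindingNumber
import Literature.Topology.PlaneTopology.ZerosPersist

/-!
# The local index of a section of an oriented plane field does not depend on the frame
(registered helper `helper_frameIndexInvariance` of the stub `stub_normalWitnessTransfer`, line
`cross-cap-laurent`, crux `GromovRecognitionRelEnd`, item stmt-SmoothPoincare4-11009)

Setting: over a disc `B(ζ₀, ρ) ⊆ ℂ` we are given a continuous oriented plane field on
`F := ℝᵐ × ℝ²`, presented by a projection `P z` and a quarter-turn `R z` of the plane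
`range (P z)` (`R z ∘ R z = - P z`, `R z` orthogonal and isometric on the plane for the pairing
`B x y := ⟪x.1, y.1⟫ + ⟪x.2, y.2⟫`, and the coordinate formula in the frame `(v, R z v)`), two
continuous frame vectors `t`, `t'` (`P t = t ≠ 0`, `P t' = t' ≠ 0`) and a continuous section `w`
of the plane field vanishing at most at the centre `ζ₀`.  The complex coordinates of `w` in the
moving frames `(t, R t)` and `(t', R t')` are `φ = B(w, t) + i B(w, R t)` and
`φ' = B(w, t') + i B(w, R t')`.

Claim (`helper_frameIndexInvariance`): on every circle `‖z - ζ₀‖ = r`, `0 < r < ρ`, the loops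
`φ ∘ circleLoop ζ₀ r` and `φ' ∘ circleLoop ζ₀ r` have the same winding number: the local index of
a zero of a section of an oriented plane bundle is independent of the positively oriented local
frame used to read it off (J. Milnor, *Topology from the Differentiable Viewpoint* (1965), §6;
the two frames differ by a map into `GL⁺(2, ℝ) ≃ ℂˣ`-valued function on a disc, which is
null-homotopic).

Proof.  Linear algebra in the oriented plane `Π = range (P z)` (sub-namespace
`HelperFrameIndexInvariance`): polarising the axioms `B(R v, P v) = 0` and `B(R v, R v) = B(P v, P v)`
gives `B(R u, v) = -B(R v, u)` and `B(R u, R v) = B(u, v)` on `Π`, whence the change-of-frame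
identity `φ' · B(t, t) = φ · κ` with `κ := B(t, t') + i B(t, R t')` the coordinate of `t` in the
frame `(t', R t')` (expand `w = a t + b R t` by the coordinate formula).  The function
`μ := κ / B(t, t)` is continuous and zero-free on the whole ball (`κ z = 0` would force `t z = 0`),
so it has a continuous logarithm on the closed disc of radius `r`
(`Literature.Topology.PlaneTopology.hasLogOn_closedBall`) and `wind (μ ∘ circleLoop ζ₀ r) = 0`
(`wind_comp_eq_zero_of_hasLogOn`); additivity of the winding number (`wind_mul`, Hatcher §1.1)
then gives `wind (φ' ∘ γ) = wind (φ ∘ γ) + 0`.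

References: J. W. Milnor, *Topology from the Differentiable Viewpoint*, Univ. Press of Virginia
(1965), §6 [MilnorTDV1965]; A. Hatcher, *Algebraic Topology*, CUP (2002), §1.1 [HatcherAT2002].
No new definitions.
-/

noncomputable section

open Set Metric Literature.Topology.PlaneTopology
open scoped Topology

-- the prescribed namespace `Summit.<P>.<Sub>.…` duplicates `SmoothPoincare4` (P = Sub)
set_option linter.dupNamespace false

namespace Summit.SmoothPoincare4.SmoothPoincare4.Theorems.GromovRecognitionRelEnd.CrossCapLaurent

namespace HelperFrameIndexInvariance

variable {E₁ E₂ : Type*} [NormedAddCommGroup E₁] [InnerProductSpace ℝ E₁] [NormedAddCommGroup E₂]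
  [InnerProductSpace ℝ E₂]

/-- Polarisation of `B(R v, P v) = 0`: on the plane `range P` the quarter-turn `R` is skew for the
pairing `B x y = ⟪x.1, y.1⟫ + ⟪x.2, y.2⟫`, i.e. `B(R u, v) = -B(R v, u)`. [folklore] -/
theorem pairing_rot_left_antisymm {P R : (E₁ × E₂) →L[ℝ] (E₁ × E₂)}
    (h5 : ∀ v, inner ℝ (R v).1 (P v).1 + inner ℝ (R v).2 (P v).2 = 0) {u v : E₁ × E₂}
    (hu : P u = u) (hv : P v = v) :
    inner ℝ (R u).1 v.1 + inner ℝ (R u).2 v.2 = -(inner ℝ (R v).1 u.1 + inner ℝ (R v).2 u.2) := by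
  have huv := h5 (u + v)
  have hu' := h5 u
  have hv' := h5 v
  rw [hu] at hu'
  rw [hv] at hv'
  simp only [map_add, hu, hv, Prod.fst_add, Prod.snd_add, inner_add_left, inner_add_right] at huv
  linear_combination huv - hu' - hv'

/-- Polarisation of `B(R v, R v) = B(P v, P v)`: on the plane `range P` the quarter-turn `R` is
an isometry for the pairing, `B(R u, R v) = B(u, v)`. [folklore] -/
theorem pairing_rot_rot {P R : (E₁ × E₂) →L[ℝ] (E₁ × E₂)}
    (h6 : ∀ v, inner ℝ (R v).1 (R v).1 + inner ℝ (R v).2 (R v).2 =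
      inner ℝ (P v).1 (P v).1 + inner ℝ (P v).2 (P v).2) {u v : E₁ × E₂}
    (hu : P u = u) (hv : P v = v) :
    inner ℝ (R u).1 (R v).1 + inner ℝ (R u).2 (R v).2 = inner ℝ u.1 v.1 + inner ℝ u.2 v.2 := by
  have huv := h6 (u + v)
  have hu' := h6 u
  have hv' := h6 v
  rw [hu] at hu'
  rw [hv] at hv'
  simp only [map_add, hu, hv, Prod.fst_add, Prod.snd_add, real_inner_add_add_self] at huv
  linear_combination (huv - hu' - hv') / 2

/-- A nonzero vector `u` of the plane has a nonzero complex coordinate `B(u, v) + i B(u, R v)` in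
the frame `(v, R v)` of the plane (coordinate formula). [folklore] -/
theorem coord_ne_zero {P R : (E₁ × E₂) →L[ℝ] (E₁ × E₂)}
    (h8 : ∀ v w', P v = v → v ≠ 0 → P w' = w' → w' = ((inner ℝ w'.1 v.1 + inner ℝ w'.2 v.2) /
      (inner ℝ v.1 v.1 + inner ℝ v.2 v.2)) • v + ((inner ℝ w'.1 (R v).1 + inner ℝ w'.2 (R v).2) /
      (inner ℝ v.1 v.1 + inner ℝ v.2 v.2)) • R v)
    {v u : E₁ × E₂} (hv : P v = v) (hv0 : v ≠ 0) (hu : P u = u) (hu0 : u ≠ 0) :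
    ((inner ℝ u.1 v.1 + inner ℝ u.2 v.2 : ℝ) : ℂ) +
      ((inner ℝ u.1 (R v).1 + inner ℝ u.2 (R v).2 : ℝ) : ℂ) * Complex.I ≠ 0 := by
  intro h0
  have hre := congrArg Complex.re h0
  have him := congrArg Complex.im h0
  simp only [Complex.add_re, Complex.ofReal_re, Complex.mul_re, Complex.I_re, mul_zero,
    Complex.ofReal_im, Complex.I_im, mul_one, sub_zero, add_zero, Complex.zero_re,
    Complex.add_im, Complex.mul_im, zero_add, Complex.zero_im] at hre him
  have key := h8 v u hv hv0 hu
  rw [hre, him, zero_div, zero_smul, zero_smul, add_zero] at key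
  exact hu0 key

/-- **Change of frame.** For two frame vectors `t, t'` of the plane and a vector `w` of the plane,
the complex coordinates `c_t(w) = B(w, t) + i B(w, R t)` and `c_{t'}(w)` satisfy
`c_{t'}(w) · B(t, t) = c_t(w) · c_{t'}(t)`. [folklore] -/
theorem coord_change {P R : (E₁ × E₂) →L[ℝ] (E₁ × E₂)}
    (h5 : ∀ v, inner ℝ (R v).1 (P v).1 + inner ℝ (R v).2 (P v).2 = 0)
    (h6 : ∀ v, inner ℝ (R v).1 (R v).1 + inner ℝ (R v).2 (R v).2 =
      inner ℝ (P v).1 (P v).1 + inner ℝ (P v).2 (P v).2)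
    (h8 : ∀ v w', P v = v → v ≠ 0 → P w' = w' → w' = ((inner ℝ w'.1 v.1 + inner ℝ w'.2 v.2) /
      (inner ℝ v.1 v.1 + inner ℝ v.2 v.2)) • v + ((inner ℝ w'.1 (R v).1 + inner ℝ w'.2 (R v).2) /
      (inner ℝ v.1 v.1 + inner ℝ v.2 v.2)) • R v)
    {t t' w : E₁ × E₂} (ht : P t = t) (ht0 : t ≠ 0) (ht' : P t' = t') (hw : P w = w) :
    (((inner ℝ w.1 t'.1 + inner ℝ w.2 t'.2 : ℝ) : ℂ) +
        ((inner ℝ w.1 (R t').1 + inner ℝ w.2 (R t').2 : ℝ) : ℂ) * Complex.I) *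
      ((inner ℝ t.1 t.1 + inner ℝ t.2 t.2 : ℝ) : ℂ) =
    (((inner ℝ w.1 t.1 + inner ℝ w.2 t.2 : ℝ) : ℂ) +
        ((inner ℝ w.1 (R t).1 + inner ℝ w.2 (R t).2 : ℝ) : ℂ) * Complex.I) *
      (((inner ℝ t.1 t'.1 + inner ℝ t.2 t'.2 : ℝ) : ℂ) +
        ((inner ℝ t.1 (R t').1 + inner ℝ t.2 (R t').2 : ℝ) : ℂ) * Complex.I) := by
  set Btt := inner ℝ t.1 t.1 + inner ℝ t.2 t.2
  set a := (inner ℝ w.1 t.1 + inner ℝ w.2 t.2) / Btt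
  set b := (inner ℝ w.1 (R t).1 + inner ℝ w.2 (R t).2) / Btt
  have hB : Btt ≠ 0 := (HelperSphereSectionOfIndexZero.pairing_self_pos ht0).ne'
  have hdec : w = a • t + b • R t := h8 t w ht ht0 hw
  have ha : a * Btt = inner ℝ w.1 t.1 + inner ℝ w.2 t.2 := div_mul_cancel₀ _ hB
  have hb : b * Btt = inner ℝ w.1 (R t).1 + inner ℝ w.2 (R t).2 := div_mul_cancel₀ _ hB
  -- pairings of `w = a t + b R t` against `t'` and `R t'`
  have e1 : inner ℝ w.1 t'.1 + inner ℝ w.2 t'.2 =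
      a * (inner ℝ t.1 t'.1 + inner ℝ t.2 t'.2) +
        b * (inner ℝ (R t).1 t'.1 + inner ℝ (R t).2 t'.2) := by
    rw [hdec]
    simp only [Prod.fst_add, Prod.snd_add, Prod.smul_fst, Prod.smul_snd, inner_add_left,
      real_inner_smul_left]
    ring
  have e2 : inner ℝ w.1 (R t').1 + inner ℝ w.2 (R t').2 =
      a * (inner ℝ t.1 (R t').1 + inner ℝ t.2 (R t').2) +
        b * (inner ℝ (R t).1 (R t').1 + inner ℝ (R t).2 (R t').2) := by
    rw [hdec]
    simp only [Prod.fst_add, Prod.snd_add, Prod.smul_fst, Prod.smul_snd, inner_add_left,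
      real_inner_smul_left]
    ring
  -- `B(R t, t') = -B(t, R t')` and `B(R t, R t') = B(t, t')`
  have f1 : inner ℝ (R t).1 t'.1 + inner ℝ (R t).2 t'.2 =
      -(inner ℝ t.1 (R t').1 + inner ℝ t.2 (R t').2) := by
    rw [pairing_rot_left_antisymm h5 ht ht', real_inner_comm t.1, real_inner_comm t.2]
  have f2 : inner ℝ (R t).1 (R t').1 + inner ℝ (R t).2 (R t').2 =
      inner ℝ t.1 t'.1 + inner ℝ t.2 t'.2 := pairing_rot_rot h6 ht ht'
  apply Complex.ext
  · simp only [Complex.add_re, Complex.ofReal_re, Complex.mul_re, Complex.I_re, mul_zero,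
      Complex.ofReal_im, Complex.I_im, mul_one, sub_zero, add_zero, Complex.add_im,
      Complex.mul_im, zero_add]
    linear_combination Btt * e1 + (inner ℝ t.1 t'.1 + inner ℝ t.2 t'.2) * ha +
      (inner ℝ (R t).1 t'.1 + inner ℝ (R t).2 t'.2) * hb +
      (inner ℝ w.1 (R t).1 + inner ℝ w.2 (R t).2) * f1
  · simp only [Complex.add_re, Complex.ofReal_re, Complex.mul_re, Complex.I_re, mul_zero,
      Complex.ofReal_im, Complex.I_im, mul_one, sub_zero, add_zero, Complex.add_im,
      Complex.mul_im, zero_add]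
    linear_combination Btt * e2 + (inner ℝ t.1 (R t').1 + inner ℝ t.2 (R t').2) * ha +
      (inner ℝ (R t).1 (R t').1 + inner ℝ (R t).2 (R t').2) * hb +
      (inner ℝ w.1 (R t).1 + inner ℝ w.2 (R t).2) * f2

end HelperFrameIndexInvariance

open HelperFrameIndexInvariance HelperSphereSectionOfIndexZero in
/-- **Registered helper `helper_frameIndexInvariance`: the local index of a section of an oriented
plane field, read off in a positively oriented moving frame, does not depend on the frame.**
With the notation of the module docstring, `wind (φ ∘ circleLoop ζ₀ r) = wind (φ' ∘ circleLoop ζ₀ r)`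
for `0 < r < ρ`: `φ' = φ · μ` on the ball with `μ = (B(t,t') + i B(t,Rt')) / B(t,t)` continuous
and zero-free on the closed disc, hence of winding number `0` along the circle. [folklore] -/
theorem helper_frameIndexInvariance : ∀ (m : ℕ) (P R : ℂ → (EuclideanSpace ℝ (Fin m) × EuclideanSpace ℝ (Fin 2)) →L[ℝ] (EuclideanSpace ℝ (Fin m) × EuclideanSpace ℝ (Fin 2))) (t t' w : ℂ → EuclideanSpace ℝ (Fin m) × EuclideanSpace ℝ (Fin 2)) (φ φ' : ℂ → ℂ) (ζ₀ : ℂ) (ρ : ℝ), 0 < ρ → ContinuousOn P (Metric.ball ζ₀ ρ) → ContinuousOn R (Metric.ball ζ₀ ρ) → ContinuousOn t (Metric.ball ζ₀ ρ) → ContinuousOn t' (Metric.ball ζ₀ ρ) → ContinuousOn w (Metric.ball ζ₀ ρ) → (∀ z ∈ Metric.ball ζ₀ ρ, (∀ v, P z (P z v) = P z v) ∧ (∀ v, P z (R z v) = R z v) ∧ (∀ v, R z (P z v) = R z v) ∧ (∀ v, R z (R z v) = - P z v) ∧ (∀ v, inner ℝ (R z v).1 (P z v).1 + inner ℝ (R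 z v).2 (P z v).2 = 0) ∧ (∀ v, inner ℝ (R z v).1 (R z v).1 + inner ℝ (R z v).2 (R z v).2 = inner ℝ (P z v).1 (P z v).1 + inner ℝ (P z v).2 (P z v).2) ∧ P z ≠ 0 ∧ (∀ v w', P z v = v → v ≠ 0 → P z w' = w' → w' = ((inner ℝ w'.1 v.1 + inner ℝ w'.2 v.2) / (inner ℝ v.1 v.1 + inner ℝ v.2 v.2)) • v + ((inner ℝ w'.1 (R z v).1 + inner ℝ w'.2 (R z v).2) / (inner ℝ v.1 v.1 + inner ℝ v.2 v.2)) • R z v)) → (∀ z ∈ Metric.ball ζ₀ ρ, P z (t z) = t z ∧ t z ≠ 0 ∧ P z (t' z) = t' z ∧ t' z ≠ 0 ∧ P z (w z) = w z) → (∀ z ∈ Metric.ball ζ₀ ρ, z ≠ ζ₀ → w z ≠ 0) → (∀ z, φ z = ((inner ℝ (w z).1 (t z).1 + inner ℝ (w z).2 (t z).2 : ℝ) : ℂ) + ((inner ℝ (w z).1 (R z (t z)).1 + inner ℝ (w z).2 (R z (t z)).2 : ℝ) : ℂ) * Complex.I) → (∀ z, φ' z = ((inner ℝ (w z).1 (t'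 z).1 + inner ℝ (w z).2 (t' z).2 : ℝ) : ℂ) + ((inner ℝ (w z).1 (R z (t' z)).1 + inner ℝ (w z).2 (R z (t' z)).2 : ℝ) : ℂ) * Complex.I) → ∀ r : ℝ, 0 < r → r < ρ → Literature.Topology.PlaneTopology.wind (fun τ => φ (Literature.Topology.PlaneTopology.circleLoop ζ₀ r τ)) = Literature.Topology.PlaneTopology.wind (fun τ => φ' (Literature.Topology.PlaneTopology.circleLoop ζ₀ r τ)) := by
  intro m P R t t' w φ φ' ζ₀ ρ _hρ _hP hR ht ht' hw hax htw hw0 hφ hφ' r hr hrρ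
  -- the two auxiliary functions: `κ z = c_{t' z}(t z)` and `μ = κ / B(t, t)`
  obtain ⟨κ, hκ⟩ : ∃ κ : ℂ → ℂ, ∀ z, κ z =
      ((inner ℝ (t z).1 (t' z).1 + inner ℝ (t z).2 (t' z).2 : ℝ) : ℂ) +
        ((inner ℝ (t z).1 (R z (t' z)).1 + inner ℝ (t z).2 (R z (t' z)).2 : ℝ) : ℂ) * Complex.I :=
    ⟨_, fun _ => rfl⟩
  obtain ⟨μ, hμ⟩ : ∃ μ : ℂ → ℂ, ∀ z, μ z =
      κ z / ((inner ℝ (t z).1 (t z).1 + inner ℝ (t z).2 (t z).2 : ℝ) : ℂ) :=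
    ⟨_, fun _ => rfl⟩
  -- `B(t, t) ≠ 0`, `κ ≠ 0`, `μ ≠ 0` on the ball, and the change-of-frame identity `φ' = φ μ`
  have hB0 : ∀ z ∈ ball ζ₀ ρ,
      ((inner ℝ (t z).1 (t z).1 + inner ℝ (t z).2 (t z).2 : ℝ) : ℂ) ≠ 0 := fun z hz =>
    Complex.ofReal_ne_zero.2 (pairing_self_pos (htw z hz).2.1).ne'
  have hκ0 : ∀ z ∈ ball ζ₀ ρ, κ z ≠ 0 := fun z hz => by
    obtain ⟨-, -, -, -, -, -, -, h8⟩ := hax z hz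
    obtain ⟨htz, ht0, ht'z, ht'0, -⟩ := htw z hz
    rw [hκ]
    exact coord_ne_zero h8 ht'z ht'0 htz ht0
  have hμ0 : ∀ z ∈ ball ζ₀ ρ, μ z ≠ 0 := fun z hz => by
    rw [hμ]
    exact div_ne_zero (hκ0 z hz) (hB0 z hz)
  have hφμ : ∀ z ∈ ball ζ₀ ρ, φ' z = φ z * μ z := fun z hz => by
    obtain ⟨-, -, -, -, h5, h6, -, h8⟩ := hax z hz
    obtain ⟨htz, ht0, ht'z, -, hwz⟩ := htw z hz
    have key := coord_change h5 h6 h8 (t' := t' z) htz ht0 ht'z hwz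
    rw [← hφ z, ← hφ' z, ← hκ z] at key
    rw [hμ, mul_div_assoc', eq_div_iff (hB0 z hz)]
    exact key
  -- `φ` vanishes only at the centre
  have hφ0 : ∀ z ∈ ball ζ₀ ρ, z ≠ ζ₀ → φ z ≠ 0 := fun z hz hzζ => by
    obtain ⟨-, -, -, -, -, -, -, h8⟩ := hax z hz
    obtain ⟨htz, ht0, -, -, hwz⟩ := htw z hz
    rw [hφ]
    exact coord_ne_zero h8 htz ht0 hwz (hw0 z hz hzζ)
  -- continuity of `φ` and `μ` on the ball
  have hRt : ContinuousOn (fun z => R z (t z)) (ball ζ₀ ρ) := hR.clm_apply ht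
  have hRt' : ContinuousOn (fun z => R z (t' z)) (ball ζ₀ ρ) := hR.clm_apply ht'
  have hφc : ContinuousOn φ (ball ζ₀ ρ) := by
    rw [show φ = _ from funext hφ]
    exact (Complex.continuous_ofReal.comp_continuousOn
      ((hw.fst.inner ht.fst).add (hw.snd.inner ht.snd))).add
      ((Complex.continuous_ofReal.comp_continuousOn
        ((hw.fst.inner hRt.fst).add (hw.snd.inner hRt.snd))).mul continuousOn_const)
  have hκc : ContinuousOn κ (ball ζ₀ ρ) := by
    rw [show κ = _ from funext hκ]
    exact (Complex.continuous_ofReal.comp_continuousOn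
      ((ht.fst.inner ht'.fst).add (ht.snd.inner ht'.snd))).add
      ((Complex.continuous_ofReal.comp_continuousOn
        ((ht.fst.inner hRt'.fst).add (ht.snd.inner hRt'.snd))).mul continuousOn_const)
  have hμc : ContinuousOn μ (ball ζ₀ ρ) := by
    rw [show μ = _ from funext hμ]
    exact hκc.div (Complex.continuous_ofReal.comp_continuousOn
      ((ht.fst.inner ht.fst).add (ht.snd.inner ht.snd))) hB0
  -- the circle of radius `r` lies in the punctured ball
  have hγb : ∀ τ, circleLoop ζ₀ r τ ∈ ball ζ₀ ρ := fun τ =>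
    closedBall_subset_ball hrρ (sphere_subset_closedBall (circleLoop_mem_sphere ζ₀ hr.le τ))
  have hγne : ∀ τ, circleLoop ζ₀ r τ ≠ ζ₀ := fun τ =>
    ne_of_mem_sphere (circleLoop_mem_sphere ζ₀ hr.le τ) hr.ne'
  have hγc : Continuous (circleLoop ζ₀ r) := continuous_circleLoop ζ₀ r
  -- the two loops `φ ∘ γ` and `μ ∘ γ`
  have hφloop : IsNonvanishingLoop fun τ => φ (circleLoop ζ₀ r τ) :=
    ⟨hφc.comp hγc.continuousOn fun τ _ => hγb τ, fun τ _ => hφ0 _ (hγb τ) (hγne τ),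
      by rw [circleLoop_zero_eq]⟩
  have hμloop : IsNonvanishingLoop fun τ => μ (circleLoop ζ₀ r τ) :=
    ⟨hμc.comp hγc.continuousOn fun τ _ => hγb τ, fun τ _ => hμ0 _ (hγb τ),
      by rw [circleLoop_zero_eq]⟩
  -- `μ` has a logarithm on the closed disc of radius `r`, so `μ ∘ γ` does not wind
  have hlog : HasLogOn μ (closedBall ζ₀ r) :=
    hasLogOn_closedBall (hμc.mono (closedBall_subset_ball hrρ))
      fun z hz => hμ0 z (closedBall_subset_ball hrρ hz)
  have hμw : wind (fun τ => μ (circleLoop ζ₀ r τ)) = 0 :=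
    wind_comp_eq_zero_of_hasLogOn hlog hγc.continuousOn
      (fun τ _ => sphere_subset_closedBall (circleLoop_mem_sphere ζ₀ hr.le τ))
      (circleLoop_zero_eq ζ₀ r)
  symm
  calc wind (fun τ => φ' (circleLoop ζ₀ r τ))
      = wind (fun τ => φ (circleLoop ζ₀ r τ) * μ (circleLoop ζ₀ r τ)) :=
        wind_congr fun τ _ => hφμ _ (hγb τ)
    _ = wind (fun τ => φ (circleLoop ζ₀ r τ)) + wind (fun τ => μ (circleLoop ζ₀ r τ)) :=
        wind_mul hφloop hμloop
    _ = wind (fun τ => φ (circleLoop ζ₀ r τ)) := by rw [hμw, add_zero]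

end Summit.SmoothPoincare4.SmoothPoincare4.Theorems.GromovRecognitionRelEnd.CrossCapLaurent

end
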